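import Summits.QuantumFields.BalabanUV.T4Continuum.Spine.NE1p.DressedStabilityOfRStepSliceWinSchedules
import Summits.QuantumFields.BalabanUV.T4Continuum.Spine.NE1p.DressedTransportAssembledModData

/-!
# T⁴ programme, spine estimate NE1′ (node O3b/H2) — THE CANONICAL TERMINAL FACE THROUGH THE ℝ-STEP SEAM: END-ALL-slice-win ∘
# SUPPLIERS over the CANONICAL DATA with L-B read off the consumer row's own datum `RStep` (swarm item «S3l.1» of
# `t4/formal/NE1p/LEAVES.md`; INTENT HOME/CLAIMS.log l.11162; own-lineage follow-through of S3k.1 p215059 at S3l's p215128 substitution)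

Cell `pub-balaban`, sub-cell `t4`, BINDER-OWNERS row NE1′ (owner lineage t4-ne1p-p1; root `Spine/NE1p/DressedRoot.lean` p211416);
formalisation crew `b2b-balaban-t4-ne1p-formalise-*`, seat `…-leaf-02` (gen 3; lineage rows S5b ∕ W3 ∕ S6b ∕ S3e ∕ S3i ∕ S5e ∕ S3j ∕ W8 ∕
S3k.1).  ADDITIVE — imports this seat's `Spine/NE1p/DressedStabilityOfRStepSliceWinSchedules` (row S3k.1 p215059: the terminal
slice-window face through the ℝ-step seam, `hbirth := hbirth_of_rstep_cell`; through it leaf-09-g2's S3k p214938, S3h-2 p214712, S3i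
p214477, S5e p214587, rows S4 ∕ S5b ∕ S8) and leaf-01's `Spine/NE1p/DressedTransportAssembledModData` (row S2i p213820: the plain
recursions `aszRec` ∕ `s1Mod` and their defining equations `aszRec_birth` ∕ `aszRec_succ` ∕ `s1Mod_eq`) ONLY; modifies nothing.
Siblings: S3l `DressedStabilityOfCanonicalSliceWinSchedules` p215128 (canonical data, LIVE-FAMILY birth door — leaf-09-g3) and S3k.1
(bookkeeping functions displayed, ℝ-step seam).  This file is the fourth corner: canonical data AND ℝ-step seam.

WHY.  After S3l the terminal face displays no bookkeeping function and no bookkeeping equality, but reads leaf L-B through the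
live-family door: absorbed families `Sabs a K` POSITED per `(a,K)` with «strictly older» `holder` and «among the live families» `hsub`
as dictionary and `AbsorbsFrom … Sabs …` (`habs`).  Row O3.E-iii-c (the ℝ operation's consumer) supplies instead ONE datum
`Rs a K : T4PreservedUnderR.RStep (𝒯.B a K)` per run parameter and cutoff — absorbed families `absorbs`, strictly older by
`absorbs_lt`, felt at the renormalised component by `absorbs_felt`, at most `vR` cubes (`CompVol vR`) — and S5e's
`hbirth_of_rstep_cell` DERIVES the absorbed count from the anchoring.  S3k.1 composed that seam into S3k; this file composes it into
S3l, i.e. it is S3k.1's three theorems BY NAME at the canonical data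
`s1 a K := s1Mod (𝒯.T a K).gen r (fun _ => alphaCell κ) (c a K) (Sg a K) (δf a K)` (closed-form fresh step budget, modulus form) and
`Asz a K := aszRec (𝒯.T a K).gen (s a K) (s1 a K)` (slice sizes), the three bookkeeping binders `hs1` ∕ `hAsz_birth` ∕ `hAsz_step`
DISCHARGED by S2i's `s1Mod_eq` ∕ `aszRec_birth` ∕ `aszRec_succ` — S3l's substitution verbatim, nothing re-proved:
* §1 the tower-level binders ONCE as section variables = S3k.1's list MINUS {`hs1`, `hAsz_birth`, `hAsz_step`} and minus the
  implicit families {`s1`, `Asz`}; the H2 dictionary `hQ` ∕ `hSg` (what the canonical budget is computed from), the two binders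
  particular to the slice-window face `hcm` ∕ `hδfwk`, `hvN₀` ∕ `hA` and the fan-out pair at the DERIVED absorbed multiplicity `vR·mB`
  sit in each theorem's header (statements header-distinct from S3l — pair at `N₀`, live door — and from S3k.1 — no dictionary in
  the header).
* §2 **`dressedStabilityWith_of_canonicalRStepSliceWinSchedules`** (constants `(A₀, rhoOne L⁻² (4c_δ∕r) c̄ κ, L⁻³)` displayed),
  **`dressedStability_of_canonicalRStepSliceWinSchedules : DressedStability 𝒯`** (the row root literally) and ROOT-B
  **`dressedBudget_of_canonicalRStepSliceWinSchedules : DressedBudget 𝒯 wt`**.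
BINDER DIFF vs S3l (mechanical): −{`holder`, `hsub`, `habs`} (and the family `Sabs`) +{`Rs`, `hcv`, `hpre`, `hlaw`}; header pair at
`vR·mB` instead of `N₀`.  BINDER DIFF vs S3k.1: −{`hs1`, `hAsz_birth`, `hAsz_step`} (and the families `s1`, `Asz`); `hQ` ∕ `hSg`
moved from §1 into the headers.  Everything else VERBATIM; conclusions literal.

EFFECT — WHAT IS DISPLAYED AFTER THIS FACE, AND NOTHING ELSE (per `(a,K)` unless marked ONCE): the WALL ∕ Q leaves of `DAG.md` §2 —
(w1) `hsl`; (w2-act) `hB` ∕ `hE` ∕ `hs₀` (printed TYPE [Balaban1989LargeFieldII] (1.65) p. 375, (1.71)–(1.75) pp. 379–380 — THE NUMBER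
`s̄⁰` stays a binder, (w6) `hsmall` ONCE); (w5) `hreg` + `hc0` ∕ `hcb`; (I4′) `hδf` ∕ `hδfwk` ∕ `hpairx` ∕ `hdefwk` ∕ `hrate` + the
cutoff-free source tie `hcm` (F-6's rate `ψ = L⁻²`, caveat k3 — load-bearing); the seam `hpre` (pre-ℝ sizes below the transported
envelope under the dressed history); the F-2 ∕ H2 dictionary `hFn` ∕ `h𝒢` ∕ `hQ` ∕ `hSg` ∕ `hmeas`; F-9 context `hinv` ∕ `hDμ` ∕ `hz₁` —
plus instantiation DATA (one ratio-bounded `WindowScheduleModWin` per `(a,K)` — ONE cutoff-free geometric schedule serves all, exact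
admissibility = summability (S1g); anchoring `Anch` ∕ `hLb` ∕ `hmult` ∕ `hscale` ∕ `hhoused` ∕ `hvol`; the ℝ-step `Rs` ∕ `hcv` ∕ `hlaw` ∕
`hβ`; booking convention `hne` ∕ `hsup`) and row S3's located scalars ONCE before `∀ a K` (`κ L c̄ N₀ A₀ s̄⁰ ρ′ r c_δ m v vR mB A β₀`;
`hloc : locCell … ≤ ρ′ < 1`, `hsmall`, `hvN₀`, `hfan`, `hamp`).  NO structural leaf, NO `hP`, NO radius floor, NO uniform-`w` window
budget, NO `K·w`, NO posited count, NO posited absorbed family, NO bookkeeping function, NO bookkeeping equality.  R4 rider (caveat k1,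
inherited from rows S4 ∕ S3i ∕ S3k.1 and restated so the face is self-contained): the component volumes `v` (housing) and `vR`
(`CompVol`) and the multiplicity `mB` are bound ONCE — the form in which a COLLARED met component (row S4 `DressedPositionalCount`) is
K-free; it is the ONE K-free instantiation demand of L-C ∕ L-B and is NOT asserted here for Bałaban's large-field components.

HONEST FRAMING.  A COMPOSITION FACE: 0 estimates, 0 new hypothesis shapes, no `def`, NO `def … : Prop`, every wall binder displayed
verbatim as S3h-2 ∕ S3k ∕ S3k.1 display it ([folklore] kernel glue; 0 sorry; 0 citations used as facts).  Headline (c4): «NE1′ (all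
cutoffs, all run parameters) ⇐ EXACTLY the displayed WALL binders ∀ (a,K) + the H2 dictionary + anchoring ∕ ℝ-step ∕
booking-convention DATA + located largeness + ratio-bounded cutoff-free-window schedules» — NOT «NE1′ proved», NOT printed: the walls
are asserted for Bałaban's densities NOWHERE; 0 binders instantiated on Bałaban's densities; spine PROVED 0∕9.  Rung (B)+1 on ONE
finite four-torus — NOT infinite volume, NOT a mass gap, NOT OS on ℝ⁴, NOT the Clay problem.
HONEST DEPENDENCY: continuum YM on T⁴ ⇐ BetaPertH ∧ nine spine estimates (0/9 proved); BetaPertH ⇐ (D1) ∧ (D4) ∧ CAP+tail; G-an2-4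
gates asym, D1 and NE2/3/4.
-/

noncomputable section

namespace Summit.QuantumFields.BalabanUV.T4Continuum.NE1p.DressedStabilityOfCanonicalRStepSliceWinSchedules

open MeasureTheory Set Metric Finset
open scoped BigOperators
open Literature.MathematicalPhysics.QuantumFieldTheory.Balaban1983to89
open Literature.MathematicalPhysics.QuantumFieldTheory.Balaban1983to89.T4TermFormat
open Literature.MathematicalPhysics.QuantumFieldTheory.Balaban1983to89.T4FeltGeometry
open Literature.MathematicalPhysics.QuantumFieldTheory.Balaban1983to89.T4GatedBooking
open Literature.MathematicalPhysics.QuantumFieldTheory.Balaban1983to89.T4TrajectoryComparison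
open Literature.MathematicalPhysics.QuantumFieldTheory.Balaban1983to89.T4TrajectoryModulus
open Literature.MathematicalPhysics.QuantumFieldTheory.Balaban1983to89.T4PreservedUnderR (RStep)
open T4BirthChartTransport (GaugeInvariant BirthSlice RelGauge)
open T4BlockTransport (Fld NDir latMove latN)
open T4TrajectoryDensity
open Summit.QuantumFields.BalabanUV.T4Continuum.T4TrajectoryDensityDressed
open Summit.QuantumFields.BalabanUV.T4Continuum.NE1p.DressedRoot
open Summit.QuantumFields.BalabanUV.T4Continuum.NE1p.DressedWindowScheduleWin
open Summit.QuantumFields.BalabanUV.T4Continuum.NE1p.DressedWindowScheduleModWin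
open Summit.QuantumFields.BalabanUV.T4Continuum.NE1p.DressedUniformConstants
open Summit.QuantumFields.BalabanUV.T4Continuum.NE1p.DressedTransportUniformWin
open Summit.QuantumFields.BalabanUV.T4Continuum.NE1p.DressedTransportAssembledModData
open Summit.QuantumFields.BalabanUV.T4Continuum.NE1p.DressedStabilityOfSliceWinSchedules
open Summit.QuantumFields.BalabanUV.T4Continuum.NE1p.DressedStabilityOfSuppliedSchedules
open Summit.QuantumFields.BalabanUV.T4Continuum.NE1p.DressedStabilityOfRStepSliceWinSchedules
open Summit.QuantumFields.BalabanUV.T4Continuum.NE1p.DressedAbsorptionWindow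
open Summit.QuantumFields.BalabanUV.T4Continuum.NE1p.DressedAttainment
open Summit.QuantumFields.BalabanUV.T4Continuum.NE1p.DressedBirthRStepAnchored

/-! ## §1 The tower-level binders, once — S3k.1's list minus `hs1` ∕ `hAsz_birth` ∕ `hAsz_step` and minus the families `s1` ∕ `Asz` -/

section EndAll

variable {P : Type*} (𝒯 : DressedTower P)
variable {R : Type*} [NormedRing R] [NormedAlgebra ℂ R] [MeasurableSpace R] {d : ℕ}
variable {κ L cbar N₀ A₀ sbar ρ' r cδ m : ℝ} {w : P → ℕ → ℝ}
variable (W : ∀ (a : P) (K : ℕ), WindowScheduleModWin r (w a K)) (hκ : 0 ≤ κ)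
variable {Fn : ∀ (a : P) (K : ℕ), (𝒯.B a K).Birth → ℕ → ℕ → Fld d R → ℂ}
  {rel : ∀ (a : P) (K : ℕ), (𝒯.B a K).Birth → ℕ → ℕ → Fld d R → Fld d R → Prop}
  {ref : ∀ (a : P) (K : ℕ), (𝒯.B a K).Birth → ℕ → Fld d R → Fld d R}
  {base : ∀ (a : P) (K : ℕ), (𝒯.B a K).Birth → ℕ → Fld d R → ℝ}
  {𝒜 𝒬 : ∀ (a : P) (K : ℕ), (𝒯.B a K).Birth → ℕ → Fld d R → Fld d R → ℂ}
  {q : ∀ (a : P) (K : ℕ), (𝒯.B a K).Birth → ℕ → Fld d R → ℂ}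
  {μ : ∀ (a : P) (K : ℕ), (𝒯.B a K).Birth → ℕ → Measure (Fld d R)}
  {z₀ z₁ : ∀ (a : P) (K : ℕ), (𝒯.B a K).Birth → ℕ → Fld d R}
  {defect : ∀ (a : P) (K : ℕ), (𝒯.B a K).Birth → ℕ → ℕ → ℝ}
  {s : ∀ (a : P) (K : ℕ), (𝒯.B a K).Birth → ℕ → ℝ}
  {S : ∀ (a : P) (K : ℕ), ℕ → (𝒯.B a K).Birth → Finset (𝒯.B a K).Birth}
  {Sg : ∀ (a : P) (K : ℕ), ℕ → (𝒯.B a K).Birth → Finset ((𝒯.B a K).Birth × ℕ)}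
  {c : ∀ (a : P) (K : ℕ), (𝒯.B a K).Birth → ℕ → ℂ}
  {δf : ∀ (a : P) (K : ℕ), (𝒯.B a K).Birth → ℕ → (𝒯.B a K).Birth × ℕ → ℝ}
  {creg : ∀ (_ : P) (_ : ℕ), ℕ → ℝ}
-- DATA replacing the structural leaves: anchoring + met-component housing (L-C, as in S3k ∕ S3l), the ℝ-step (L-B, as in S3k.1)
variable {Lb mB v vR : ℕ} (Anch : ∀ (a : P) (K : ℕ), Anchoring (𝒯.B a K) 4 Lb)
  {comp : ∀ (a : P) (K : ℕ), ℕ → (𝒯.B a K).Birth → Finset (𝒯.B a K).Cube}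
  (Rs : ∀ (a : P) (K : ℕ), RStep (𝒯.B a K))
  {β : ∀ (_ : P) (_ : ℕ), ℕ → ℝ} {A β₀ : ℝ}

-- the ratio family (K-free κ)
variable (hratio : ∀ (a : P) (K : ℕ), ∀ k, 2 * (W a K).σ k ≤ κ * (W a K).ϱc k)
-- row S3's located scalars ((w7) largeness, (w6) window) and signs — ONCE
variable (hL : 1 ≤ L)
variable (hcbar : 0 ≤ cbar)
variable (hN₀ : 0 ≤ N₀)
variable (hA₀ : 0 ≤ A₀)
variable (hm : 0 ≤ m)
variable (hloc : locCell L (4 * cδ / r) cbar κ ≤ ρ')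
variable (hρ'1 : ρ' < 1)
variable (hsmall : m * (N₀ * A₀ * (1 - ρ')⁻¹) ≤ 1 - sbar)
variable (hr : 0 < r)
variable (hcδ : 0 ≤ cδ)
-- the assembled END's estimate families (S3k ∕ S3k.1 ∕ S3l verbatim)
variable (hsl : ∀ (a : P) (K : ℕ), ∀ (b : (𝒯.B a K).Birth) (k' : ℕ), (𝒯.B a K).birthScale b ≤ k' → k' ≤ (𝒯.B a K).K →
  RanBelow (budgetGate (𝒯.T a K) (s a K) m (S a K) (4 * cδ / r) (fun i => (L ^ 2)⁻¹ * (fun _ : ℕ => alphaCell κ) i)) k' →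
  BirthSlice ((Fn a K) b k' k') latMove latN (bondBall d ((W a K).ρw k') : Set (Fld d R)) ((W a K).wc k') r ((𝒯.T a K).gen b k'))
variable (hFn : ∀ (a : P) (K : ℕ), ∀ (b : (𝒯.B a K).Birth) (k' k : ℕ), (𝒯.B a K).birthScale b ≤ k' → k' ≤ k →
  k + 1 ≤ (𝒯.B a K).K →
  RanBelow (budgetGate (𝒯.T a K) (s a K) m (S a K) (4 * cδ / r) (fun i => (L ^ 2)⁻¹ * (fun _ : ℕ => alphaCell κ) i)) (k + 1) →
  ∀ U, (Fn a K) b k' (k + 1) U =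
    wOp (expWeight ((base a K) b k) ((𝒜 a K) b k + (𝒬 a K) b k)) ((μ a K) b k) ((z₀ a K) b k) U (fun z => (Fn a K) b k' k (U + z)))
variable (h𝒢 : ∀ (a : P) (K : ℕ), ∀ (b : (𝒯.B a K).Birth) (k' k : ℕ), (𝒯.B a K).birthScale b ≤ k' → k' ≤ k →
  k + 1 ≤ (𝒯.B a K).K →
  RanBelow (budgetGate (𝒯.T a K) (s a K) m (S a K) (4 * cδ / r) (fun i => (L ^ 2)⁻¹ * (fun _ : ℕ => alphaCell κ) i)) (k + 1) →
  ∀ U, (fun z => (Fn a K) b k' k (U + z)) ∈ BddClass ℂ ((μ a K) b k))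
variable (hB : ∀ (a : P) (K : ℕ), ∀ (b : (𝒯.B a K).Birth) (k' k : ℕ), (𝒯.B a K).birthScale b ≤ k' → k' ≤ k →
  k + 1 ≤ (𝒯.B a K).K →
  RanBelow (budgetGate (𝒯.T a K) (s a K) m (S a K) (4 * cδ / r) (fun i => (L ^ 2)⁻¹ * (fun _ : ℕ => alphaCell κ) i)) (k + 1) →
  RealBaseAt ((ref a K) b k) ((base a K) b k) ((𝒜 a K) b k) ((μ a K) b k) (bondBall d ((W a K).ρw (k + 1)) : Set (Fld d R)))
variable (hE : ∀ (a : P) (K : ℕ), ∀ (b : (𝒯.B a K).Birth) (k' k : ℕ), (𝒯.B a K).birthScale b ≤ k' → k' ≤ k →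
  k + 1 ≤ (𝒯.B a K).K →
  RanBelow (budgetGate (𝒯.T a K) (s a K) m (S a K) (4 * cδ / r) (fun i => (L ^ 2)⁻¹ * (fun _ : ℕ => alphaCell κ) i)) (k + 1) →
  ExponentSliceAt ((ref a K) b k) ((𝒜 a K) b k) ((μ a K) b k) latMove latN (bondBall d ((W a K).ρw (k + 1)) : Set (Fld d R))
    ((W a K).wc (k + 1)) ((W a K).ϱc k) ((s a K) b k))
variable (hδf : ∀ (a : P) (K : ℕ), ∀ b k, ∀ x ∈ (Sg a K) k b, 0 ≤ (δf a K) b k x ∧ (δf a K) b k x ≤ cδ * ((L ^ 2)⁻¹) ^ (k - x.2))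
variable (hDμ : ∀ (a : P) (K : ℕ), ∀ b k, ∀ᵐ z ∂(μ a K) b k, z ∈ (bondBall d ((W a K).σ k) : Set (Fld d R)))
variable (hz₁ : ∀ (a : P) (K : ℕ), ∀ b k, (z₁ a K) b k ∈ (bondBall d ((W a K).σ k) : Set (Fld d R)))
variable (hpairx : ∀ (a : P) (K : ℕ), ∀ (b : (𝒯.B a K).Birth) (k' k : ℕ), (𝒯.B a K).birthScale b ≤ k' → k' ≤ k →
  ∀ x ∈ (Sg a K) k b, ∀ U₀ ∈ (bondBall d ((W a K).ρw (k + 1)) : Set (Fld d R)), ∀ pd : NDir d R, 0 < latN pd →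
    latN pd ≤ (W a K).wc (k + 1) →
    ∀ᵐ z ∂(μ a K) b k, ∀ t ∈ tube ((W a K).ϱ₁ k / latN pd),
      RelGauge ((rel a K) x.1 x.2 k) latMove latN (latMove U₀ pd t + (z₁ a K) b k) (latMove U₀ pd t + z) ((δf a K) b k x))
variable (hinv : ∀ (a : P) (K : ℕ), ∀ b k' k, GaugeInvariant ((rel a K) b k' k) ((Fn a K) b k' k))
variable (hmeas : ∀ (a : P) (K : ℕ), ∀ (b f : (𝒯.B a K).Birth) (k'' k : ℕ) (U : Fld d R),
  AEStronglyMeasurable (fun z => (Fn a K) f k'' k (U + z)) ((μ a K) b k))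
variable (hdefwk : ∀ (a : P) (K : ℕ), ∀ (b : (𝒯.B a K).Birth) (k' k : ℕ), (defect a K) b k' k ≤ (W a K).wc k)
variable (hrate : ∀ (a : P) (K : ℕ), ∀ (b : (𝒯.B a K).Birth) (k' k : ℕ), (𝒯.B a K).birthScale b ≤ k' → k' ≤ k → k ≤ (𝒯.B a K).K →
  (defect a K) b k' k ≤ cδ * ((L ^ 2)⁻¹) ^ (k - k'))
-- F-8 REPLACED BY THE BOOKING CONVENTION (row S8): admissible pairs exist, booked size ≤ sup of realised increments
variable (hne : ∀ (a : P) (K : ℕ), ∀ (b : (𝒯.B a K).Birth) (k' k : ℕ), (𝒯.B a K).birthScale b ≤ k' → k' ≤ k → k ≤ (𝒯.B a K).K →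
  RanBelow (budgetGate (𝒯.T a K) (s a K) m (S a K) (4 * cδ / r) (fun i => (L ^ 2)⁻¹ * (fun _ : ℕ => alphaCell κ) i)) k →
  ∃ U₀ ∈ (bondBall d ((W a K).ρw k) : Set (Fld d R)), ∃ U₁ : Fld d R,
  RelGauge ((rel a K) b k' k) latMove latN U₀ U₁ ((defect a K) b k' k))
variable (hsup : ∀ (a : P) (K : ℕ), ∀ (b : (𝒯.B a K).Birth) (k' k : ℕ), (𝒯.B a K).birthScale b ≤ k' → k' ≤ k → k ≤ (𝒯.B a K).K →
  RanBelow (budgetGate (𝒯.T a K) (s a K) m (S a K) (4 * cδ / r) (fun i => (L ^ 2)⁻¹ * (fun _ : ℕ => alphaCell κ) i)) k →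
  (𝒯.T a K).lin b k' k ≤ sSup {x : ℝ | ∃ U₀ ∈ (bondBall d ((W a K).ρw k) : Set (Fld d R)), ∃ U₁ : Fld d R,
    RelGauge ((rel a K) b k' k) latMove latN U₀ U₁ ((defect a K) b k' k) ∧ x = ‖(Fn a K) b k' k U₁ - (Fn a K) b k' k U₀‖})
-- the booking-level wall binders: (w5) regeneration, (w2-act) margin
variable (hc0 : ∀ (a : P) (K : ℕ), ∀ k, 0 ≤ (creg a K) k)
variable (hcb : ∀ (a : P) (K : ℕ), ∀ k, k < (𝒯.B a K).K → (creg a K) k ≤ cbar)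
variable (hreg : ∀ (a : P) (K : ℕ), (𝒯.T a K).RegeneratesFromVar (creg a K)
  (budgetGate (𝒯.T a K) (s a K) m (S a K) (4 * cδ / r) (fun _ : ℕ => (L ^ 2)⁻¹ * alphaCell κ)))
variable (hs₀ : ∀ (a : P) (K : ℕ), ∀ b k, (s a K) b k ≤ sbar)
-- (w3-book) L-C REPLACED BY ANCHORING DATA (row S4): blocking integer, multiplicity, housing, component volume
variable (hLb : (Lb : ℝ) = L)
variable (hmult : ∀ (a : P) (K : ℕ), ∀ j (x : Fin 4 → ℕ),
  ((𝒯.B a K).births.filter fun b => (𝒯.B a K).birthScale b = j ∧ x ∈ (Anch a K).dom b).card ≤ mB)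
variable (hscale : ∀ (a : P) (K : ℕ), ∀ k b, ∀ q ∈ (comp a K) k b, (𝒯.B a K).cubeScale q = k)
variable (hhoused : ∀ (a : P) (K : ℕ), ∀ k b, ∀ f ∈ (S a K) k b, ∃ q ∈ (comp a K) k b, f ∈ (𝒯.B a K).feltAt q)
variable (hvol : ∀ (a : P) (K : ℕ), ∀ k b, ((comp a K) k b).card ≤ v)
-- (w1)+(w5b) L-B REPLACED BY THE ℝ-STEP SEAM (rows S5 §3 ∕ S5e, as in S3k.1): component volume, pre-ℝ sizes below the transported
-- envelope under the dressed history, the absorption law («budgets add»), dressing sizes; the fan-out pair sits in the theorem headers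
variable (hcv : ∀ (a : P) (K : ℕ), (Rs a K).CompVol vR)
variable (hpre : ∀ (a : P) (K : ℕ), (𝒯.T a K).PreBelowEnv (Rs a K) (4 * cδ / r) (fun _ : ℕ => (L ^ 2)⁻¹ * alphaCell κ)
  (budgetGate (𝒯.T a K) (s a K) m (S a K) (4 * cδ / r) (fun _ : ℕ => (L ^ 2)⁻¹ * alphaCell κ)))
variable (hlaw : ∀ (a : P) (K : ℕ), (𝒯.T a K).AbsorbLaw (Rs a K) (4 * cδ / r) (β a K) A)
variable (hβ : ∀ (a : P) (K : ℕ), ∀ j, j ≤ (𝒯.B a K).K → (β a K) j ≤ β₀ * (L⁻¹ ^ 3) ^ ((𝒯.B a K).K - j))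

include W hκ Anch Rs hratio hL hcbar hN₀ hA₀ hm hloc hρ'1 hsmall hr hcδ hsl hFn h𝒢 hB hE hδf hDμ hz₁ hpairx hinv hmeas hdefwk hrate
  hne hsup hc0 hcb hreg hs₀ hLb hmult hscale hhoused hvol hcv hpre hlaw hβ

/-! ## §2 END-ALL-slice-win ∘ suppliers over the canonical data through the ℝ-step seam: the row root (both forms) and ROOT-B -/

/-- **THE CANONICAL TERMINAL FACE THROUGH THE ℝ-STEP SEAM — THE ROW ROOT WITH ITS CONSTANTS DISPLAYED** [bookkeeping]: S3k.1's
`dressedStabilityWith_of_rstepSliceWinSchedules` BY NAME at the canonical data `s1 a K := s1Mod (𝒯.T a K).gen r (alphaCell κ) (c a K)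
(Sg a K) (δf a K)` (the closed-form fresh step budget, modulus form) and `Asz a K := aszRec (𝒯.T a K).gen (s a K) (s1 a K)` (the slice
sizes), its three bookkeeping binders being S2i's `s1Mod_eq` ∕ `aszRec_birth` ∕ `aszRec_succ`; inside S3k.1, F-8 `hlin` comes from the
booking convention (`hlin_budgetGate_of_lin_le_sSup`), L-C `hS` ∕ `hcount` from the anchoring (`count_of_anchoring_cell`) and L-B
`hbirth` from the ℝ-step `Rs a K` (`hbirth_of_rstep_cell`).  The header displays the H2 dictionary `hQ` ∕ `hSg` (the source factor
`c` and the live generations `Sg` the canonical budget is computed from), the two binders particular to the slice-window face (`hcm`,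
`hδfwk`), then the supplier scalars with the fan-out pair at the DERIVED absorbed multiplicity `vR·mB`.  The scalars
(`κ L c̄ N₀ A₀ s̄⁰ ρ′ r c_δ m v vR mB A β₀`) precede `∀ a K`.  NOT «NE1′ proved»: every wall binder displayed; 0 instantiated on
Bałaban's densities. [folklore] -/
theorem dressedStabilityWith_of_canonicalRStepSliceWinSchedules
    -- the H2 dictionary the canonical data are built from
    (hQ : ∀ (a : P) (K : ℕ), ∀ b k, (fun U z => (𝒬 a K) b k U z - (q a K) b k U) =
      fun U z => (c a K) b k * ∑ x ∈ (Sg a K) k b, ((Fn a K) x.1 x.2 k (U + z) - (Fn a K) x.1 x.2 k (U + (z₁ a K) b k)))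
    (hSg : ∀ (a : P) (K : ℕ), ∀ k b, ∀ x ∈ (Sg a K) k b, x.1 ∈ (S a K) k b ∧ (𝒯.B a K).birthScale x.1 ≤ x.2 ∧ x.2 ≤ k)
    -- the two binders PARTICULAR to the assembled slice-window face (cutoff-free source tie, per-step slice guard)
    (hcm : ∀ (a : P) (K : ℕ), ∀ b k, ‖(c a K) b k‖ ≤ m)
    (hδfwk : ∀ (a : P) (K : ℕ), ∀ b k, ∀ x ∈ (Sg a K) k b, (δf a K) b k x ≤ (W a K).wc k)
    (hvN₀ : (v : ℝ) * mB ≤ N₀) (hA : 0 ≤ A)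
    (hfan : fanout A ((vR : ℝ) * mB) ρ' < 1) (hamp : absorbAmplitude β₀ A ((vR : ℝ) * mB) ρ' ≤ A₀) :
    DressedStabilityWith 𝒯 A₀ (rhoOne (L ^ 2)⁻¹ (4 * cδ / r) cbar κ) (L⁻¹ ^ 3) :=
  dressedStabilityWith_of_rstepSliceWinSchedules 𝒯 W hκ
    (s1 := fun a K => s1Mod (𝒯.T a K).gen r (fun _ : ℕ => alphaCell κ) (c a K) (Sg a K) (δf a K))
    (Asz := fun a K =>
      aszRec (𝒯.T a K).gen (s a K) (s1Mod (𝒯.T a K).gen r (fun _ : ℕ => alphaCell κ) (c a K) (Sg a K) (δf a K)))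
    Anch Rs hratio hL hcbar hN₀ hA₀ hm hloc hρ'1 hsmall hr hcδ hsl hFn h𝒢 hB hE hQ hSg
    (fun a K b k => s1Mod_eq (𝒯.T a K).gen r (fun _ : ℕ => alphaCell κ) (c a K) (Sg a K) (δf a K) b k)
    (fun a K f k'' =>
      aszRec_birth (𝒯.T a K).gen (s a K) (s1Mod (𝒯.T a K).gen r (fun _ : ℕ => alphaCell κ) (c a K) (Sg a K) (δf a K)) f k'')
    (fun a K f _ _ _ hk =>
      aszRec_succ (𝒯.T a K).gen (s a K) (s1Mod (𝒯.T a K).gen r (fun _ : ℕ => alphaCell κ) (c a K) (Sg a K) (δf a K)) f hk)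
    hδf hDμ hz₁ hpairx hinv hmeas hdefwk hrate hne hsup hc0 hcb hreg hs₀ hLb hmult hscale hhoused hvol hcv hpre hlaw hβ hcm hδfwk
    hvN₀ hA hfan hamp

/-- **THE CANONICAL TERMINAL FACE THROUGH THE ℝ-STEP SEAM — THE ROW ROOT `DressedStability 𝒯` LITERALLY** [bookkeeping]: «NE1′ (all
cutoffs, all run parameters) ⇐ EXACTLY the displayed WALL binders ∀ (a,K) + the H2 dictionary + anchoring ∕ ℝ-step ∕
booking-convention DATA + located largeness + ratio-bounded cutoff-free-window schedules», with NO bookkeeping function or equality and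
NO posited absorbed family displayed; NOT proved; nothing instantiated on Bałaban's densities. [folklore] -/
theorem dressedStability_of_canonicalRStepSliceWinSchedules
    -- the H2 dictionary the canonical data are built from
    (hQ : ∀ (a : P) (K : ℕ), ∀ b k, (fun U z => (𝒬 a K) b k U z - (q a K) b k U) =
      fun U z => (c a K) b k * ∑ x ∈ (Sg a K) k b, ((Fn a K) x.1 x.2 k (U + z) - (Fn a K) x.1 x.2 k (U + (z₁ a K) b k)))
    (hSg : ∀ (a : P) (K : ℕ), ∀ k b, ∀ x ∈ (Sg a K) k b, x.1 ∈ (S a K) k b ∧ (𝒯.B a K).birthScale x.1 ≤ x.2 ∧ x.2 ≤ k)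
    -- the two binders PARTICULAR to the assembled slice-window face (cutoff-free source tie, per-step slice guard)
    (hcm : ∀ (a : P) (K : ℕ), ∀ b k, ‖(c a K) b k‖ ≤ m)
    (hδfwk : ∀ (a : P) (K : ℕ), ∀ b k, ∀ x ∈ (Sg a K) k b, (δf a K) b k x ≤ (W a K).wc k)
    (hvN₀ : (v : ℝ) * mB ≤ N₀) (hA : 0 ≤ A)
    (hfan : fanout A ((vR : ℝ) * mB) ρ' < 1) (hamp : absorbAmplitude β₀ A ((vR : ℝ) * mB) ρ' ≤ A₀) :
    DressedStability 𝒯 :=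
  ⟨_, _, _, dressedStabilityWith_of_canonicalRStepSliceWinSchedules 𝒯 W hκ Anch Rs hratio hL hcbar hN₀ hA₀ hm hloc hρ'1 hsmall hr
    hcδ hsl hFn h𝒢 hB hE hδf hDμ hz₁ hpairx hinv hmeas hdefwk hrate hne hsup hc0 hcb hreg hs₀ hLb hmult hscale hhoused hvol hcv hpre
    hlaw hβ hQ hSg hcm hδfwk hvN₀ hA hfan hamp⟩

/-- **THE CANONICAL TERMINAL FACE THROUGH THE ℝ-STEP SEAM ⟹ ROOT-B `DressedBudget 𝒯 wt`** [bookkeeping]: with nonnegative cube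
weights bounded by `w̄` and the SAME anchoring read as the bookings' positional count (`1 ≤ v`), S3k.1's
`dressedBudget_of_rstepSliceWinSchedules` BY NAME at the canonical data. [folklore] -/
theorem dressedBudget_of_canonicalRStepSliceWinSchedules
    -- the H2 dictionary the canonical data are built from
    (hQ : ∀ (a : P) (K : ℕ), ∀ b k, (fun U z => (𝒬 a K) b k U z - (q a K) b k U) =
      fun U z => (c a K) b k * ∑ x ∈ (Sg a K) k b, ((Fn a K) x.1 x.2 k (U + z) - (Fn a K) x.1 x.2 k (U + (z₁ a K) b k)))
    (hSg : ∀ (a : P) (K : ℕ), ∀ k b, ∀ x ∈ (Sg a K) k b, x.1 ∈ (S a K) k b ∧ (𝒯.B a K).birthScale x.1 ≤ x.2 ∧ x.2 ≤ k)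
    -- the two binders PARTICULAR to the assembled slice-window face (cutoff-free source tie, per-step slice guard)
    (hcm : ∀ (a : P) (K : ℕ), ∀ b k, ‖(c a K) b k‖ ≤ m)
    (hδfwk : ∀ (a : P) (K : ℕ), ∀ b k, ∀ x ∈ (Sg a K) k b, (δf a K) b k x ≤ (W a K).wc k)
    (hvN₀ : (v : ℝ) * mB ≤ N₀) (hA : 0 ≤ A)
    (hfan : fanout A ((vR : ℝ) * mB) ρ' < 1) (hamp : absorbAmplitude β₀ A ((vR : ℝ) * mB) ρ' ≤ A₀)
    {wt : P → ℕ → ℕ → ℝ} {wbar : ℝ} (hwbar : 0 ≤ wbar)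
    (hw0 : ∀ a K, ∀ j ≤ K, 0 ≤ wt a K j) (hwb : ∀ a K, ∀ j ≤ K, wt a K j ≤ wbar) (hv : 1 ≤ v) :
    DressedBudget 𝒯 wt :=
  dressedBudget_of_rstepSliceWinSchedules 𝒯 W hκ
    (s1 := fun a K => s1Mod (𝒯.T a K).gen r (fun _ : ℕ => alphaCell κ) (c a K) (Sg a K) (δf a K))
    (Asz := fun a K =>
      aszRec (𝒯.T a K).gen (s a K) (s1Mod (𝒯.T a K).gen r (fun _ : ℕ => alphaCell κ) (c a K) (Sg a K) (δf a K)))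
    Anch Rs hratio hL hcbar hN₀ hA₀ hm hloc hρ'1 hsmall hr hcδ hsl hFn h𝒢 hB hE hQ hSg
    (fun a K b k => s1Mod_eq (𝒯.T a K).gen r (fun _ : ℕ => alphaCell κ) (c a K) (Sg a K) (δf a K) b k)
    (fun a K f k'' =>
      aszRec_birth (𝒯.T a K).gen (s a K) (s1Mod (𝒯.T a K).gen r (fun _ : ℕ => alphaCell κ) (c a K) (Sg a K) (δf a K)) f k'')
    (fun a K f _ _ _ hk =>
      aszRec_succ (𝒯.T a K).gen (s a K) (s1Mod (𝒯.T a K).gen r (fun _ : ℕ => alphaCell κ) (c a K) (Sg a K) (δf a K)) f hk)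
    hδf hDμ hz₁ hpairx hinv hmeas hdefwk hrate hne hsup hc0 hcb hreg hs₀ hLb hmult hscale hhoused hvol hcv hpre hlaw hβ hcm hδfwk
    hvN₀ hA hfan hamp hwbar hw0 hwb hv

end EndAll

end Summit.QuantumFields.BalabanUV.T4Continuum.NE1p.DressedStabilityOfCanonicalRStepSliceWinSchedules

end
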